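import Summits.CriticalPhenomena.PercolationContinuityZ3.Theorems.Transplant.SkelConcRootClauses
import Summits.CriticalPhenomena.PercolationContinuityZ3.Theorems.Transplant.SkelConcParamsRoot
import Summits.CriticalPhenomena.PercolationContinuityZ3.Theorems.Transplant.SkelAdvPackaging
import HarnessLib

/-!
# L7 (Z), part (R): the ROOT obligation of the CONCRETE GENERIC choice function — `SkelConc.rootHolds_concChoice₀` (= `RootHoldsFn concChoice₀`, unfolded) —
# p2's `Skel.rootOblA_concSG_kits` (the (R) residue of the concentric scheme of record over a planar skeleton, kit form, SkelConcRootClauses)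
# instantiated at stmt-g7's `SkelConc.concChoice₀` through the `AtQ` unpacking of `SkelConcParamsAtQ` / `SkelConcParamsRoot`, then
# `Skel.rootOblT_of_rootOblA` — generic twin of `BoxProdZ2ConcRootHolds` (`BoxProdZ2.rootHoldsFn_concChoice₀`)

builds on p205010 (kernel theorem, internal audit signed; external expert review pending) — nothing in this file uses p205010.
Status sentence (coordinator 2026-08-20T04:30Z): "θ(p_c) = 0 on ℤ^d, all d ≥ 2 — kernel-verified (Lean 4/Mathlib, standard axioms); internal
adversarial audit SIGNED 2026-08-20 04:29Z; external expert review pending."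
Lane `prim-bschramm-*`, seat `prim-bschramm-p2` (gen 5; (R) wrapper); helper file (`--supports stmt-CriticalPhenomena-4575`).

Constants fed (CONC-PARAMS-GENERIC.md + the (R) binder list of `rootOblA_concSG_kits`): `t := Conc.tc`, `R' := Conc.R'c = L + 8 M₀ + 13`,
level window `j₀ := 8 M₀ + 13`, `j₁ := Rlev := 8 M₀ + 12 + L` (so `Rlev + 1 = R'` and `T₀ = 3 M₀ + 4 ≤ j₀`), `ℓ₀ := M₀ + 1`, `N := Conc.Nc`,
`kk := Conc.kc`, scales `Ssc := Conc.Sc = Icc M₀ (6t)`, seed slab `ℓs := M₀ + 1`, `R′_seed := Conc.Rseedc`, `r₀ := Conc.r₀c`, `rs := Conc.rsc`,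
accuracy `κ.δr 44` (inputs at `δmin² ≤ (δr 44)²`), `η := Conc.ηc = δmin/2 ≤ δr 44 / 2`, excess radius `R₁ := Conc.Rexc q (E₀ + 1)` at planar diameter
`60 r`, root tube `Rt := Conc.Rt = F 1 − L' − 1`, schedule `Λ := Conc.Λc = Skel.concRadiiS C gap 0 E₀ L'`, first hop `R₀ := 40 t + ψ M₀`, scale `6t`.
* **`SkelConc.rootHolds_concChoice₀`** — `(concChoice₀ κ G Φ hc t ht h0 p hp0 hp1 hC).RootHolds` at every admissible centred instance
  (= `RootHoldsFn concChoice₀` unfolded; the folded one-liner would duplicate the product's printed statement and is left to (Z')).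
[cite: KozmaNitzan2024, §4 Theorem 6 (pp. 25–31), (32) at the root (p. 28), Lemma 11 (pp. 22–23)]
-/

noncomputable section

open MeasureTheory
open scoped Classical

namespace Summit.CriticalPhenomena.PercolationContinuityZ3.Theorems

namespace Transplant

namespace SkelConc

open Literature.Probability.Percolation Literature.Probability.LatticeModels SimpleGraph KNCells KNLevels
open BoxProdZ2 (δmin δmin_le_δr)

/-- **The root obligation (R) of the concrete generic choice function, at every admissible centred instance** (the `RootHoldsFn concChoice₀`
form is NOT restated: its printed statement coincides with the product's `BoxProdZ2.rootHoldsFn_concChoice₀` under the gate's statement dedup —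
(Z') applies this per-instance theorem). [cite: KozmaNitzan2024, §4 Theorem 6, (32) at the root (p. 28); Lemma 11 (pp. 22–23)] -/
theorem rootHolds_concChoice₀ (κ : Consts) {V : Type} [DecidableEq V] [Countable V] (G : SimpleGraph V) [G.LocallyFinite]
    (Φ : PlanarSkeletonConc G) (hc : G.Connected) (t : V) (ht : t ∈ Φ.types) (h0 : Φ.φ t = 0) (p : unitInterval) (hp0 : 0 < (p : ℝ))
    (hp1 : (p : ℝ) < 1) (hC : Φ.toPlanarSkeleton.CylSubcritical p) : (concChoice₀ κ G Φ hc t ht h0 p hp0 hp1 hC).RootHolds := by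
  intro msel M₀ q hat
  -- abbreviations
  have hδA : 0 < δA Φ κ.K₀ κ.δ₂ := δA_pos Φ κ.K₀ κ.δ₂
  have ha : δmin (κ.prod Φ.Δ) Conc.nR (δA Φ κ.K₀ κ.δ₂) ≤ κ.δr 44 := δmin_le_δr (κ.prod Φ.Δ) Conc.nR (δA Φ κ.K₀ κ.δ₂)
  have hη : Conc.ηc κ Φ (δA Φ κ.K₀ κ.δ₂) ≤ κ.δr 44 / 2 := by unfold Conc.ηc; linarith [ha]
  have hΛ : Skel.WFS (Conc.Cc κ Φ p hC (δA Φ κ.K₀ κ.δ₂) M₀) (Conc.Λc κ Φ p hC (δA Φ κ.K₀ κ.δ₂) M₀ q) :=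
    (wfHoldsFn_concChoice₀ κ G Φ hc t ht h0 p hp0 hp1 hC msel M₀ q hat).1
  -- the planar numerics of the root run
  have hrℤ : ((Conc.Cc κ Φ p hC (δA Φ κ.K₀ κ.δ₂) M₀).r : ℤ) = 4 * Conc.tc κ Φ p hC (δA Φ κ.K₀ κ.δ₂) M₀ := by
    exact_mod_cast (Conc.hr (κ := κ) (Φ := Φ) (p := p) (hC := hC) (δA := δA Φ κ.K₀ κ.δ₂) (M := M₀))
  have hℓ₀ := Conc.hℓ₀ (κ := κ) (Φ := Φ) (p := p) (hC := hC) (δA := δA Φ κ.K₀ κ.δ₂) (M := M₀)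
  have hsℤ : ((Conc.R'c κ Φ p hC (δA Φ κ.K₀ κ.δ₂) M₀ : ℕ) : ℤ) + ((M₀ + 1 : ℕ) : ℤ) ≤ Conc.tc κ Φ p hC (δA Φ κ.K₀ κ.δ₂) M₀ := by
    exact_mod_cast hℓ₀
  have hR'eq := Conc.R'c_eq (κ := κ) (Φ := Φ) (p := p) (hC := hC) (δA := δA Φ κ.K₀ κ.δ₂) (M := M₀)
  have hRl : 8 * M₀ + 12 + Conc.Lc κ Φ p hC (δA Φ κ.K₀ κ.δ₂) M₀ + 1 ≤ Conc.R'c κ Φ p hC (δA Φ κ.K₀ κ.δ₂) M₀ := by rw [hR'eq]; omega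
  have hT₀ : SkelI.tanOff (M₀ + 1) M₀ = 3 * M₀ + 4 := by unfold SkelI.tanOff; omega
  have hj₀ : SkelI.tanOff (M₀ + 1) M₀ ≤ 8 * M₀ + 12 + 1 := by rw [hT₀]; omega
  -- the seed-kit constants
  obtain ⟨hk₁, hk₂, hk₃, hk₄, hk₅, hk₆⟩ := Conc.seedKit_ineqs (Φ := Φ) (p := p) (hC := hC) (M := M₀)
  have hR'₁ : Φ.cylRadMax (M₀ + 1) ((M₀ + 1) + 2 + 2 * SkelI.tanOff (M₀ + 1) M₀) ≤ Conc.Rseedc Φ p hC M₀ := by rw [hT₀]; exact hk₁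
  have hr₀₁ : (M₀ + 1) + 1 + SkelI.tanOff (M₀ + 1) M₀ + Conc.Rseedc Φ p hC M₀ ≤ Conc.r₀c Φ p hC M₀ := by rw [hT₀]; exact hk₃
  have hr₀₂ : 2 * (M₀ + 1) + 2 + SkelI.tanOff (M₀ + 1) M₀ + M₀ + Skel.fatRadius Φ hC M₀ ≤ Conc.r₀c Φ p hC M₀ := by rw [hT₀]; exact hk₄
  have hrs₁ : (M₀ + 1) + 2 + SkelI.tanOff (M₀ + 1) M₀ + Conc.Rseedc Φ p hC M₀ ≤ Conc.rsc Φ p hC M₀ := by rw [hT₀]; exact hk₅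
  have hrs₂ : 2 * (M₀ + 1) + 3 + SkelI.tanOff (M₀ + 1) M₀ + M₀ + Skel.fatRadius Φ hC M₀ ≤ Conc.rsc Φ p hC M₀ := by rw [hT₀]; exact hk₆
  have hr₀L : Conc.r₀c Φ p hC M₀ ≤ Conc.L'c κ Φ p hC (δA Φ κ.K₀ κ.δ₂) M₀ q :=
    (Conc.r₀c_le (Φ := Φ) (p := p) (hC := hC) (M := M₀)).2.trans Conc.reachK_le_L'
  -- the kit counts in the seed-slab form
  have hkc : (1 - (q : ℝ) ^ (1 + Φ.Δ * ((Φ.Δ + 1) ^ Conc.Rseedc Φ p hC M₀ + (SkelI.tanOff (M₀ + 1) M₀ + 2)) +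
      ((Φ.Δ + 1) ^ Conc.Rseedc Φ p hC M₀ + (SkelI.tanOff (M₀ + 1) M₀ + 2)) * (Φ.Δ + 1) ^ Skel.fatRadius Φ hC M₀)) ^
        Conc.kc κ Φ p hC (δA Φ κ.K₀ κ.δ₂) M₀ ≤ κ.δr 44 := by
    have h := Conc.hk_at hat hp0 hp1 ha
    rw [Conc.sBc_eq, Conc.cSc_eq, Conc.cUc_eq] at h
    rw [hT₀]
    exact h
  have hN : Conc.kc κ Φ p hC (δA Φ κ.K₀ κ.δ₂) M₀ * (Φ.Δ + 1) ^ (2 * Conc.rsc Φ p hC M₀) ≤ Conc.Nc κ Φ p hC (δA Φ κ.K₀ κ.δ₂) M₀ := by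
    have h := Conc.hN_at (κ := κ) (Φ := Φ) (hC := hC) (M := M₀) hδA hp0 hp1
    rwa [Conc.Bc_eq] at h
  -- the radii of the schedule at the root
  have hE₀1 := Conc.one_le_E₀ (κ := κ) (Φ := Φ) (p := p) (hC := hC) (δA := δA Φ κ.K₀ κ.δ₂) (M := M₀) (q := q)
  have hrad := fun du => Skel.root_radii_concRadiiS (Conc.Cc κ Φ p hC (δA Φ κ.K₀ κ.δ₂) M₀) (Conc.gapc κ Φ p hC (δA Φ κ.K₀ κ.δ₂) M₀ q)
    (fun _ => 0) (Conc.E₀c κ Φ p hC (δA Φ κ.K₀ κ.δ₂) M₀ q) (Conc.L'c κ Φ p hC (δA Φ κ.K₀ κ.δ₂) M₀ q) hE₀1 du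
  have hRtS := Conc.Rt_succ (κ := κ) (Φ := Φ) (p := p) (hC := hC) (δA := δA Φ κ.K₀ κ.δ₂) (M := M₀) (q := q)
  have hRB : ∀ du, Conc.Rt κ Φ p hC (δA Φ κ.K₀ κ.δ₂) M₀ q + 1 ≤ (Conc.Λc κ Φ p hC (δA Φ κ.K₀ κ.δ₂) M₀ q).rB 0 0 du :=
    fun du => by rw [hRtS]; exact (hrad du).1
  have hRQ : ∀ du, Conc.Rt κ Φ p hC (δA Φ κ.K₀ κ.δ₂) M₀ q + 1 ≤ (Conc.Λc κ Φ p hC (δA Φ κ.K₀ κ.δ₂) M₀ q).rQ 0 ((0 : Site 2) + stepVec du) :=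
    fun du => by rw [hRtS]; exact (hrad du).2.1
  have hRM : ∀ du, Conc.Rt κ Φ p hC (δA Φ κ.K₀ κ.δ₂) M₀ q + 1 ≤ (Conc.Λc κ Φ p hC (δA Φ κ.K₀ κ.δ₂) M₀ q).rM 0 ((0 : Site 2) + stepVec du) :=
    fun du => by rw [hRtS]; exact (hrad du).2.2.1
  have hrQ0 := Conc.rQ_zero_zero (κ := κ) (Φ := Φ) (p := p) (hC := hC) (δA := δA Φ κ.K₀ κ.δ₂) (M := M₀) (q := q)
  have hhop := Conc.firstHop_le_Rt (κ := κ) (Φ := Φ) (p := p) (hC := hC) (δA := δA Φ κ.K₀ κ.δ₂) (M := M₀) (q := q)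
  have hhopE := Conc.firstHop_top_le_E₀ (κ := κ) (Φ := Φ) (p := p) (hC := hC) (δA := δA Φ κ.K₀ κ.δ₂) (M := M₀) (q := q)
  have hhopR := Conc.firstHop_R₀_succ_le_E₀ (κ := κ) (Φ := Φ) (p := p) (hC := hC) (δA := δA Φ κ.K₀ κ.δ₂) (M := M₀) (q := q)
  -- assemble
  exact Skel.rootOblT_of_rootOblA (Skel.rootOblA_concSG_kits Φ (C := Conc.Cc κ Φ p hC (δA Φ κ.K₀ κ.δ₂) M₀) (w₀ := t)
    (Λ := Conc.Λc κ Φ p hC (δA Φ κ.K₀ κ.δ₂) M₀ q) (q := q) (δc := κ.δ) hΛ h0 hC (Δ' := Φ.Δ) (δr := κ.δr)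
    (Rt := Conc.Rt κ Φ p hC (δA Φ κ.K₀ κ.δ₂) M₀ q) (L' := Conc.L'c κ Φ p hC (δA Φ κ.K₀ κ.δ₂) M₀ q)
    (t := Conc.tc κ Φ p hC (δA Φ κ.K₀ κ.δ₂) M₀) (R' := Conc.R'c κ Φ p hC (δA Φ κ.K₀ κ.δ₂) M₀) (ℓ₀ := M₀ + 1)
    (Rlev := 8 * M₀ + 12 + Conc.Lc κ Φ p hC (δA Φ κ.K₀ κ.δ₂) M₀) (N := Conc.Nc κ Φ p hC (δA Φ κ.K₀ κ.δ₂) M₀) (j₀ := 8 * M₀ + 12 + 1)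
    (j₁ := 8 * M₀ + 12 + Conc.Lc κ Φ p hC (δA Φ κ.K₀ κ.δ₂) M₀) (M := M₀) (E₀' := Conc.E₀c κ Φ p hC (δA Φ κ.K₀ κ.δ₂) M₀ q)
    (mex := 60 * (Conc.Cc κ Φ p hC (δA Φ κ.K₀ κ.δ₂) M₀).r) (R₁ := Conc.Rexc κ Φ p hC (δA Φ κ.K₀ κ.δ₂) M₀ q (Conc.E₀c κ Φ p hC (δA Φ κ.K₀ κ.δ₂) M₀ q + 1))
    hrℤ hsℤ Conc.hR100 Conc.root_arith_M Conc.one_le_tc hRl le_rfl _ (fun _ => rfl) hRB hRQ hRM Conc.sixty_r_le_Rt (le_of_eq hrQ0)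
    (Conc.hcount_Icc_at hat hp0 hp1 ha (8 * M₀ + 12)) msel (Ssc := Conc.Sc κ Φ p hC (δA Φ κ.K₀ κ.δ₂) M₀) (κ.hδr 44).1 (κ.hδr 44).2
    (Conc.inputs_at_le hat ha) Conc.mem_Sc (Conc.mem_Sc_of Conc.le_six_tc le_rfl) (Conc.hmsel_at hat) (Nat.lt_succ_self _)
    (fun ℓ h₁ h₂ => Conc.Icc_root_subset_Sc (Finset.mem_Icc.2 ⟨h₁, h₂⟩))
    (ℓs := M₀ + 1) (Rsd := Conc.Rseedc Φ p hC M₀) (r₀ := Conc.r₀c Φ p hC M₀) (rs := Conc.rsc Φ p hC M₀) le_rfl hj₀ hR'₁ hk₂ hr₀₁ hr₀₂ hr₀L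
    hrs₁ hrs₂ Conc.hL_root Conc.L'_le_Rt (Conc.kc κ Φ p hC (δA Φ κ.K₀ κ.δ₂) M₀) hN hkc (η := Conc.ηc κ Φ (δA Φ κ.K₀ κ.δ₂)) hη le_rfl
    (Conc.hRex_at hat le_rfl t (Conc.E₀c κ Φ p hC (δA Φ κ.K₀ κ.δ₂) M₀ q + 1)) Conc.Rex_le_Rt_sub
    (by rw [hrQ0]; exact hhopR) hhop.2 (by rw [hrQ0]; exact Nat.le_of_succ_le hhopE) (fun du => lt_of_le_of_lt hhop.1 (hRB du)) hhop.1)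

end SkelConc

end Transplant

end Summit.CriticalPhenomena.PercolationContinuityZ3.Theorems

end
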